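import Summits.PneNP.PneNP.Theses.ExpanderLinearGenerators
import Summits.PneNP.PneNP.Theorems.ExpanderLinearGeneratorsExpansionForcesDepthFregeSizeTreewidth
import Literature.Computability.Complexity.CNF
import Literature.Computability.MetaComplexity.Frege
import Literature.Computability.MetaComplexity.FpLinearSystems
import Literature.Computability.MetaComplexity.ScopeExpansion
import Literature.Computability.MetaComplexity.ExpanderTreewidth
import Literature.Combinatorics.SimpleGraph.TreeDecomposition
import Literature.Computability.MetaComplexity.TseitinDepthFrege

/-!
# PneNP / ExpanderLinearGenerators — the expansion-scale law at column weight two, from the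
Galesi–Itsykson–Riazanov–Sofronova treewidth bound (stmt-PneNP-11442, conditional slice)

Route `PneNP/ExpanderLinearGenerators`, crux stmt-PneNP-11442
(`Summit.PneNP.PneNP.Theses.ExpanderLinearGenerators.ExpansionForcesDepthFregeSize`, the
EXPANSION-SCALE LAW: an unsolvable `ℓ`-sparse system over `𝔽₂` whose row supports form an
`(r, 3/4 · ℓ)`-boundary expander forces depth-`d` `textbookFrege` refutations of size `2^{r^ε}`).
The item's own text locates the known case: "Column weight 2 = graph Tseitin, where it is GIRS23 +
Håstad (treewidth)". This file makes that sentence kernel-checked MODULO the printed theorem: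

* `galesiEtAl_tseitin_treewidth_depthFrege_lowerBound` — the named fact (Galesi–Itsykson–
  Riazanov–Sofronova, MFCS 2019 / APAL 2023, Theorem 1, lower-bound half = Theorem 17): depth-`d`
  Frege proofs of `¬T(G, f)` for a connected (multi)graph `G` have size `2^{tw(G)^{Ω(1/d)}}`,
  rendered for `textbookFrege` and for Tseitin formulas presented as `sumEncoding 1 E` of a system
  `E` in which every variable occurs in exactly two rows or in none (rows = charged vertices,
  variables = edges, parallel edges allowed);
* `boundary_univ_eq_empty_of_card_filter` — such a system has no unique-neighbour variable;
* `expansionForcesDepthFregeSize_tseitin_of_galesiEtAl` — **the column-weight-two slice of the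
  crux, conditional on the named fact**: for connected graph-Tseitin systems the conclusion of
  `ExpansionForcesDepthFregeSize` holds with `ε = c/(2d)`, because `(r, 3/4 · ℓ)`-boundary
  expansion of a boundaryless family forces `tw + 1 ≥ 3(r-1)/8`
  (`Literature.Computability.MetaComplexity.mul_le_mul_treewidth_of_isBoundaryExpander`, landed for
  this purpose) and `r^{c/(2d)} ≤ (r/4)^{c/d} ≤ tw^{c/d}` once `r ≥ 16`.

The hypergraph case (column weight `≥ 3`) — the content of the crux — is untouched: no treewidth-type
lower bound for bounded-depth Frege on general sparse XOR systems is in print (Krajíček 2019,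
Problem 19.4.5).

References: N. Galesi, D. Itsykson, A. Riazanov, A. Sofronova, *Bounded-depth Frege complexity of
Tseitin formulas for all graphs*, MFCS 2019 (LIPIcs 138) 49:1–15, Theorems 1, 17; Ann. Pure Appl.
Logic 174 (2023) 103166 [GalesiEtAl2023]; J. Håstad, *On small-depth Frege proofs for Tseitin for
grids*, J. ACM 68 (2020) [Hastad2020]; J. Krajíček, *Proof complexity* (CUP 2019), §13.4, Problem
19.4.5 [KrajicekProofComplexity2019].
-/

namespace Summit.PneNP.PneNP.Theorems

set_option linter.dupNamespace false -- `Summit.PneNP.PneNP.…`: summit = sub-problem (D-0017)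

open Finset Literature.Computability.MetaComplexity Literature.Computability.Complexity
  Literature.Combinatorics.SimpleGraph

/-- A system in which every variable occurs in exactly two rows or in none (a graph-Tseitin system)
has no unique-neighbour variable: the boundary of the full row set is empty. [folklore] -/
theorem boundary_univ_eq_empty_of_card_filter {p m n : ℕ} (E : Fin m → LinEqMod p n)
    (htwo : ∀ j : Fin n, (univ.filter fun i => j ∈ (E i).supp).card = 2 ∨
      (univ.filter fun i => j ∈ (E i).supp).card = 0) :
    boundary (fun i => (E i).supp.map Fin.valEmbedding) univ = ∅ := by
  classical
  refine Finset.eq_empty_of_forall_notMem fun v hv => ?_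
  rw [mem_boundary] at hv
  obtain ⟨hcov, hdeg⟩ := hv
  obtain ⟨i, -, hi⟩ := mem_cover.1 hcov
  obtain ⟨j, -, rfl⟩ := Finset.mem_map.1 hi
  have hfilter : (univ.filter fun i : Fin m => (Fin.valEmbedding j : ℕ) ∈ (E i).supp.map
      Fin.valEmbedding) = univ.filter fun i => j ∈ (E i).supp := by
    refine Finset.filter_congr fun i _ => ?_
    exact Finset.mem_map' Fin.valEmbedding
  unfold coverDegree at hdeg
  rw [hfilter] at hdeg
  rcases htwo j with h | h <;> omega

/-- No `textbookFrege` proof of a negation has all its lines of alternation depth `0`. [folklore] -/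
theorem not_isDepthProofOf_zero_neg (π : List (PropForm ℕ)) (φ : PropForm ℕ) :
    ¬ textbookFrege.IsDepthProofOf 0 π (PropForm.neg φ) := by
  rintro ⟨⟨-, hlast⟩, hdepth⟩
  have hmem : PropForm.neg φ ∈ π := List.mem_of_getLast? hlast
  have h := hdepth _ hmem
  simp [PropForm.altDepth, PropForm.altDepthAux] at h

/-- Real-analysis step: for `r ≥ 16`, `0 ≤ e`, `r^{e} ≤ (r/4)^{2e}`. [folklore] -/
theorem rpow_le_rpow_div_four {r e : ℝ} (hr : 16 ≤ r) (he : 0 ≤ e) :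
    r ^ e ≤ (r / 4) ^ (2 * e) := by
  have hr0 : 0 ≤ r := by linarith
  have hr4 : (0 : ℝ) ≤ r / 4 := by linarith
  have h4 : (4 : ℝ) ≤ r / 4 := by linarith
  calc r ^ e = (r / 4 * 4) ^ e := by rw [div_mul_cancel₀ r (by norm_num : (4 : ℝ) ≠ 0)]
    _ = (r / 4) ^ e * (4 : ℝ) ^ e := Real.mul_rpow hr4 (by norm_num)
    _ ≤ (r / 4) ^ e * (r / 4) ^ e := by
        gcongr
    _ = (r / 4) ^ (2 * e) := by rw [← Real.rpow_add_of_nonneg hr4 he he]; ring_nf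

/-- **The column-weight-two slice of the expansion-scale law, from the GIRS treewidth bound.**
Assume `galesiEtAl_tseitin_treewidth_depthFrege_lowerBound`. Then for every locality `ℓ ≥ 1` and
depth `d` there are `ε > 0` and `R` such that for every `r ≥ R`, every `ℓ`-sparse system `E` over
`𝔽₂` whose row supports form an `(r, 3/4 · ℓ)`-boundary expander, which is unsolvable, in which
every variable occurs in exactly two rows or none (a graph-Tseitin system) and whose row graph is
connected, forces every depth-`d` `textbookFrege` proof of `¬(sumEncoding 1 E)` to have size
`≥ 2^{r^ε}` — the conclusion of `ExpansionForcesDepthFregeSize` on this class. Proof: the family is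
boundaryless, so `3(r-1)/8 ≤ tw + 1`
(`Literature.Computability.MetaComplexity.mul_le_mul_treewidth_of_isBoundaryExpander`); for
`r ≥ max 16 (8 t₀ + 20)` this gives `tw ≥ t₀(d)` and `tw ≥ r/4`, and with `ε = c/(2d)`,
`r^ε ≤ (r/4)^{c/d} ≤ tw^{c/d}`. [cite: GalesiEtAl2023, Theorem 1] -/
theorem expansionForcesDepthFregeSize_tseitin_of_galesiEtAl
    (hGIRS : Literature.Computability.MetaComplexity.galesiEtAl_tseitin_treewidth_depthFrege_lowerBound) :
    ∀ (ℓ d : ℕ), 1 ≤ ℓ → ∃ ε : ℝ, 0 < ε ∧ ∃ R : ℝ, ∀ r : ℝ, R ≤ r →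
      ∀ (n m : ℕ) (E : Fin m → LinEqMod 2 n), (∀ i, (E i).supp.card ≤ ℓ) →
      IsBoundaryExpander (fun i => (E i).supp.map Fin.valEmbedding) r (3 / 4 * ℓ) →
      ¬ SystemSat E Finset.univ →
      (∀ j : Fin n, (univ.filter fun i => j ∈ (E i).supp).card = 2 ∨
        (univ.filter fun i => j ∈ (E i).supp).card = 0) →
      ∀ G : SimpleGraph (Fin m),
        (∀ i i' : Fin m, G.Adj i i' ↔ i ≠ i' ∧ ((E i).supp ∩ (E i').supp).Nonempty) →
        G.Connected →
      ∀ π : List (PropForm ℕ),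
        textbookFrege.IsDepthProofOf d π (PropForm.neg (PropForm.ofCNF (sumEncoding 1 E))) →
          (2 : ℝ) ^ (r ^ ε) ≤ (proofSize π : ℝ) := by
  classical
  obtain ⟨c, hc, H⟩ := hGIRS
  intro ℓ d hℓ
  obtain ⟨t₀, Ht⟩ := H d
  -- depth 0: no proof of a negation exists, any positive `ε` works
  rcases Nat.eq_zero_or_pos d with rfl | hd
  · refine ⟨1, one_pos, 0, fun r _ n m E _ _ _ _ G _ _ π hπ => ?_⟩
    exact absurd hπ (not_isDepthProofOf_zero_neg π _)
  have hd' : (0 : ℝ) < d := by exact_mod_cast hd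
  refine ⟨c / (2 * d), by positivity, max 16 (8 * t₀ + 20), fun r hr n m E hsparse hexp _ htwo G hG
    hconn π hπ => ?_⟩
  have hr16 : (16 : ℝ) ≤ r := le_trans (le_max_left _ _) hr
  have hrt : (8 * t₀ + 20 : ℝ) ≤ r := le_trans (le_max_right _ _) hr
  -- the system is boundaryless, hence its row graph has treewidth ≥ 3(r-1)/8 - 1
  haveI : Nonempty (Fin m) := hconn.nonempty
  set S : Fin m → Finset ℕ := fun i => (E i).supp.map Fin.valEmbedding with hS
  have hℓ' : ∀ i, (S i).card ≤ ℓ := fun i => by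
    simp only [hS, Finset.card_map]; exact hsparse i
  have hc' : (0 : ℝ) < 3 / 4 * ℓ := by
    have : (1 : ℝ) ≤ ℓ := by exact_mod_cast hℓ
    positivity
  have hcl : boundary S Finset.univ = ∅ := boundary_univ_eq_empty_of_card_filter E htwo
  have hG' : ∀ i i' : Fin m, i ≠ i' → (S i ∩ S i').Nonempty → G.Adj i i' := fun i i' hne h =>
    (hG i i').2 ⟨hne, inter_supp_nonempty_of_inter_map_nonempty _ _ h⟩
  have key := mul_le_mul_treewidth_of_isBoundaryExpander hℓ' hc' hexp hcl G hG'
  -- `3/4 ℓ (r-1)/2 ≤ ℓ (tw + 1)`, i.e. `3(r-1)/8 ≤ tw + 1`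
  have hℓ0 : (0 : ℝ) < ℓ := by exact_mod_cast hℓ
  have htw : 3 * (r - 1) / 8 ≤ (treewidth G + 1 : ℕ) := by
    have key' : (ℓ : ℝ) * (3 * (r - 1) / 8) ≤ ℓ * (treewidth G + 1 : ℕ) := by
      calc (ℓ : ℝ) * (3 * (r - 1) / 8) = 3 / 4 * ℓ * (r - 1) / 2 := by ring
        _ ≤ _ := key
    exact le_of_mul_le_mul_left key' hℓ0
  push_cast at htw
  -- consequences: `t₀ ≤ tw` and `r/4 ≤ tw`
  have htw₀ : t₀ ≤ treewidth G := by
    have : (t₀ : ℝ) ≤ treewidth G := by linarith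
    exact_mod_cast this
  have htw4 : r / 4 ≤ (treewidth G : ℝ) := by linarith
  -- the named fact
  have hsize := Ht n m E G htwo hG hconn htw₀ π hπ
  refine le_trans ?_ hsize
  -- `r^{c/(2d)} ≤ (r/4)^{c/d} ≤ tw^{c/d}`
  have hcd : (0 : ℝ) ≤ c / d := by positivity
  have h1 : r ^ (c / (2 * d)) ≤ (r / 4) ^ (c / d) := by
    have := rpow_le_rpow_div_four (e := c / (2 * d)) hr16 (by positivity)
    convert this using 2
    field_simp
  have h2 : (r / 4) ^ (c / d) ≤ (treewidth G : ℝ) ^ (c / d) :=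
    Real.rpow_le_rpow (by linarith) htw4 hcd
  have h12 : r ^ (c / (2 * d)) ≤ (treewidth G : ℝ) ^ (c / d) := h1.trans h2
  exact Real.rpow_le_rpow_of_exponent_le (by norm_num) h12

end Summit.PneNP.PneNP.Theorems
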